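import Mathlib.RingTheory.AdicCompletion.LocalRing
import Mathlib.RingTheory.AdicCompletion.AsTensorProduct
import Mathlib.RingTheory.Flat.FaithfullyFlat.Algebra
import Mathlib.RingTheory.LocalRing.RingHom.Basic
import HarnessLib

/-!
# [OURS · L1 W4.2 · D14 ROUTE H · H∞-a] Order transport through a formal frame

Sub-problem `ResolutionOfSingularities`, crux `SigmaMaxModifications` / conjunct `SigmaMaxModificationsCorridor3`
(route `HilbertSamuelElimination`, line `w_ladder`), idea chain L1 C5 «K1 FREE-RATIONAL TAILS», ROUTE H (hypersurface cell).

The base formal frame of `…IsoTailsFormalFrameBase` is `ψ₀ = Ψ⁻¹ ∘ (R → R̂)` with `Ψ : κ⟦X⟧ ≃+* R̂` and the recorded clause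
`Ψ (ψ₀ r) = algebraMap R R̂ r`.  The arc contradiction `FormalFrame.not_isIsolatedInHSMaxLocus_of_frameTower`
(`…IsoTailsArcContradiction`) needs the ORDER of the local equation read in the power series ring:
`ψ₀ h ∉ 𝔪_{κ⟦X⟧}^{m+1}`.  This file transports `𝔪`-adic orders through such a frame:

* `comap_pow_maximalIdeal_adicCompletion` — `𝔪_{R̂}^n ∩ R = 𝔪_R^n` for a Noetherian local ring (`R̂` is faithfully flat over `R`);
* `mem_pow_maximalIdeal_iff_of_frame` — for ANY ring isomorphism `Ψ : S ≃+* R̂` of local rings and `ψ : R →+* S` with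
  `Ψ ∘ ψ = (R → R̂)`: `ψ r ∈ 𝔪_S^n ↔ r ∈ 𝔪_R^n`; and its two one-sided corollaries.

Everything here is OURS (elementary commutative algebra on Mathlib's `AdicCompletion`); no statement of the manuscript under
adjudication and no published theorem is asserted. References for the folklore: H. Matsumura, *Commutative Ring Theory* (1986),
Thm. 8.10–8.11 p. 60–61 (`𝔪^n R̂ ∩ R = 𝔪^n`, faithful flatness of the completion) [Matsumura1987].
-/

set_option linter.dupNamespace false -- mandated namespace of this single-conjunct summit
open IsLocalRing

namespace Summit.ResolutionOfSingularities.ResolutionOfSingularities.Cruxes.SigmaMaxModifications.IdeasL1C5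

namespace FormalFrame

universe u v

variable {R : Type u} [CommRing R] [IsLocalRing R] [IsNoetherianRing R]

/-- [OURS · L1 W4.2] `𝔪_{R̂}^n ∩ R = 𝔪_R^n` for the adic completion `R̂ = AdicCompletion 𝔪 R` of a Noetherian local ring:
`𝔪_{R̂} = 𝔪 R̂` (Mathlib) and `R̂` is faithfully flat over `R`. [cite: Matsumura1987, Thm. 8.11] -/
theorem comap_pow_maximalIdeal_adicCompletion (n : ℕ) :
    (maximalIdeal (AdicCompletion (maximalIdeal R) R) ^ n).comap
        (algebraMap R (AdicCompletion (maximalIdeal R) R)) = maximalIdeal R ^ n := by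
  haveI : Module.FaithfullyFlat R (AdicCompletion (maximalIdeal R) R) :=
    Module.FaithfullyFlat.of_flat_of_isLocalHom
  rw [AdicCompletion.maximalIdeal_eq_map, ← Ideal.map_pow, Ideal.comap_map_eq_self_of_faithfullyFlat]

/-- [OURS · L1 W4.2] Membership in powers of the maximal ideal of `R̂` is read in `R`:
`algebraMap R R̂ r ∈ 𝔪_{R̂}^n ↔ r ∈ 𝔪_R^n`. [cite: Matsumura1987, Thm. 8.11] -/
theorem algebraMap_mem_pow_maximalIdeal_adicCompletion_iff (r : R) (n : ℕ) :
    algebraMap R (AdicCompletion (maximalIdeal R) R) r ∈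
        maximalIdeal (AdicCompletion (maximalIdeal R) R) ^ n ↔ r ∈ maximalIdeal R ^ n := by
  rw [← Ideal.mem_comap, comap_pow_maximalIdeal_adicCompletion]

variable {S : Type v} [CommRing S] [IsLocalRing S]

/-- [OURS · L1 W4.2] **Order transport through a frame.** If `Ψ : S ≃+* R̂` is a ring isomorphism of local rings and
`ψ : R →+* S` satisfies `Ψ (ψ r) = algebraMap R R̂ r` (the clause recorded by `exists_baseFrame_of_rsop`), then
`ψ r ∈ 𝔪_S^n ↔ r ∈ 𝔪_R^n` for every `r : R` and `n : ℕ`. [folklore] -/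
theorem mem_pow_maximalIdeal_iff_of_frame (Ψ : S ≃+* AdicCompletion (maximalIdeal R) R) (ψ : R →+* S)
    (hΨψ : ∀ r, Ψ (ψ r) = algebraMap R (AdicCompletion (maximalIdeal R) R) r) (r : R) (n : ℕ) :
    ψ r ∈ maximalIdeal S ^ n ↔ r ∈ maximalIdeal R ^ n := by
  rw [← algebraMap_mem_pow_maximalIdeal_adicCompletion_iff (R := R) r n, ← hΨψ, ← map_ringEquiv_maximalIdeal Ψ,
    ← Ideal.map_pow, Ideal.apply_mem_of_equiv_iff]

/-- [OURS · L1 W4.2] One-sided form used by the arc contradiction (`hord` of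
`FormalFrame.not_isIsolatedInHSMaxLocus_of_frameTower`): `r ∉ 𝔪_R^n ⇒ ψ r ∉ 𝔪_S^n`. [folklore] -/
theorem not_mem_pow_maximalIdeal_of_frame (Ψ : S ≃+* AdicCompletion (maximalIdeal R) R) (ψ : R →+* S)
    (hΨψ : ∀ r, Ψ (ψ r) = algebraMap R (AdicCompletion (maximalIdeal R) R) r) {r : R} {n : ℕ}
    (hr : r ∉ maximalIdeal R ^ n) : ψ r ∉ maximalIdeal S ^ n :=
  fun h => hr ((mem_pow_maximalIdeal_iff_of_frame Ψ ψ hΨψ r n).mp h)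

/-- [OURS · L1 W4.2] One-sided form: `r ∈ 𝔪_R^n ⇒ ψ r ∈ 𝔪_S^n` (also immediate from `IsLocalHom ψ`; recorded for symmetry).
[folklore] -/
theorem mem_pow_maximalIdeal_of_frame (Ψ : S ≃+* AdicCompletion (maximalIdeal R) R) (ψ : R →+* S)
    (hΨψ : ∀ r, Ψ (ψ r) = algebraMap R (AdicCompletion (maximalIdeal R) R) r) {r : R} {n : ℕ}
    (hr : r ∈ maximalIdeal R ^ n) : ψ r ∈ maximalIdeal S ^ n :=
  (mem_pow_maximalIdeal_iff_of_frame Ψ ψ hΨψ r n).mpr hr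

/-- [OURS · L1 W4.2] Ideal form: for an ideal `J` of `R`, `J.map ψ ≤ 𝔪_S^n ↔ J ≤ 𝔪_R^n`. [folklore] -/
theorem map_le_pow_maximalIdeal_iff_of_frame (Ψ : S ≃+* AdicCompletion (maximalIdeal R) R) (ψ : R →+* S)
    (hΨψ : ∀ r, Ψ (ψ r) = algebraMap R (AdicCompletion (maximalIdeal R) R) r) (J : Ideal R) (n : ℕ) :
    J.map ψ ≤ maximalIdeal S ^ n ↔ J ≤ maximalIdeal R ^ n := by
  rw [Ideal.map_le_iff_le_comap]
  constructor
  · intro h r hr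
    exact (mem_pow_maximalIdeal_iff_of_frame Ψ ψ hΨψ r n).mp (h hr)
  · intro h r hr
    exact (mem_pow_maximalIdeal_iff_of_frame Ψ ψ hΨψ r n).mpr (h hr)

end FormalFrame

end Summit.ResolutionOfSingularities.ResolutionOfSingularities.Cruxes.SigmaMaxModifications.IdeasL1C5
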